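import Summits.QuantumFields.YangMills.Theorems.BalabanUVNodesN16PrintLetters
import Summits.QuantumFields.BalabanUV.T4Continuum.Support.NE7EtaCovariantJunction
import Literature.MathematicalPhysics.QuantumFieldTheory.Balaban1983to89.B9Eq340HolderZd
import HarnessLib

/-!
# Route «BalabanUVNodes», cluster K4 «SpineRates» — node N16 = NE3: THE MULTI-SCALE HÖLDER DICTIONARY (repair R-β″, PRODUCER HALF, brick 1):
# THE END's covariant difference of `Z = Ad_{W⁻¹}(iηA)` `j` steps down a lattice line, transported back by the line holonomy, VERSUS print's
# [Balaban1985BackgroundPropagators] (3.40) transported quotient of `D^η_{W,μ}A` along the straight contour — exact identity through the `j × 1`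
# LADDER LOOP (non-abelian Stokes, `B7Prop1Explicit.ladder_bound`) and the estimate with `O(j·a)` plaquette errors

Cell `pub-ymgap`, seat `pub-ymgap-dag-n16-c` (R134 fan-out seat, strategy s1; HUMAN RULING D-0062; chair R424 venue), generation 4, file 23.
`--supports stmt-QuantumFields-19912 --as helper` (K3‴ `SpineGivenEndpointR13`, route rev 16; lineage K3′ 19908).  `bears_on: R4∕N16 · edge N05 → N16`.
Located item: `HOME/pub-ymgap-dag-n16-c/LOCATED-N16-HOLDER-PIN.md`, census row R-β″; consumer half = files 20∕21 (`N16HolderMultiScale` ∕ `…Rates`),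
definitions = file 22 (`N16HolderMSDefs`).

WHY.  The multi-scale β-root `N16HolderMSDefs.CovRootHolderMS` asks, per pair and inside `∃ (u, Z)`, for the member (Lip₂ᴹˢ)_β: along every lattice line the
END-framed covariant difference `(∇_μZ)(y + j•e_μ, κ) = Ad (W (y+e κ+j•e μ) μ) (Z (y+(j+1)•e μ) κ) − Z (y+j•e μ) κ`, transported back to `y` by the line holonomy
`W(y+e κ, μ)W(y+e κ+e μ, μ)⋯` (`NE7EtaCovariantJunction` §3), differs from `(∇_μZ)(y, κ)` by at most `Λ₂′ξ^{2+β}j^β`, `1 ≤ j ≤ L^k`.  Node N05's leaf of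
record supplies print's (3.40) Hölder quotient `B9Eq340HolderZd.hquot η β len W (covDerivFwd η W μ (A · κ))` over ALL admissible pairs — transport
`trans W y y' = conjR (hol W y (treeWord (y' − y)))` along the staircase, which for `y' = y + j•e_μ` IS the line through `y` (`B8Lemma1NonAbelian.treeWord_zsmul_e`).
The two lines — print's through `y` (START frame of the bond `⟨y, y+e_κ⟩`), THE END's through `y + e_κ` (END frame) — bound a `j × 1` LADDER, whose holonomy is
within `j·a` of `1` on `SmallField W a` (`B7Prop1Explicit.ladder_bound`, the non-abelian Stokes estimate of [Balaban1985Averaging] p. 25).  Generation-4 file 11 of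
n16-a (`N16PrintLetters.norm_holderDiff_AdInv_le`) is the case `j = 1` (three plaquette errors); THIS FILE does every `j`: the multi-scale member of
`Z = Ad_{W⁻¹}(iEta η A)` is `η²` × print's transported quotient term plus `(2j + O(1))·a` × (gradient ∕ sup letters) — all of which the successor's multi-scale
twins of (OUT_print) → (OUT₁₃₈) → `LandauRepB8` → END read off node N05's leaf (`zdGF3`'s Proposition-3 body) exactly as the nearest-neighbour chain does.

WHAT THIS FILE PROVES (kernel, theorems only, 0 `def`, 0 sorry; [folklore] lattice gauge kinematics):
§1 `hol_seg_nat_eq_lineProd` (the word holonomy along `seg μ j` IS the junction's line product), `trans_line_eq_Ad_hol_seg` (print's (3.40) transport at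
   displacement `j•e_μ` is `Ad` of it).
§2 `hol_ladder_seg_self` (degenerate ladder `κ = μ`: holonomy `1`), `norm_hol_ladder_seg_sub_one_le` (‖W(ladder) − 1‖ ≤ j·a on `SmallField W a`, any `κ, μ`).
§3 `lineProd_mul_inv_eq` (END-line holonomy · `W(y+j•e_μ, κ)⁻¹ = W(y,κ)⁻¹ · W(ladder)⁻¹ ·` START-line holonomy).
§4 `holderDiffMS_AdInv_eq` (THE EXACT IDENTITY at separation `j`), `norm_holderDiffMS_AdInv_le` (THE ESTIMATE: `η²·‖Ad(hol_j)(D^η_{W,μ}A_κ)(y+j•e_μ) −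
   (D^η_{W,μ}A_κ)(y)‖ + 2(j·a)(η²‖D^η_{W,μ}A_κ(y+j•e_μ)‖ + 2a‖(iηA)(y+(j+1)•e_μ,κ)‖) + 2a(‖(iηA)(y+(j+1)•e_μ,κ)‖ + ‖(iηA)(y+e_μ,κ)‖)`).
§5 `norm_trans_sub_le_of_hquot_le` (a bound on print's (3.40) quotient at an admissible pair bounds the transported difference by `B·(η·len)^β`),
   `norm_Ad_hol_seg_sub_le_of_hquot_le` (the same along the line, in the `Ad (hol W y (seg μ j))` letter of §4).
§6 `msError_rpow_bounds` (`j·η⁴, η³, j·η⁵ ≤ η^{2+β}·j^β` for `0 < η ≤ 1`, `1 ≤ j`, `j·η ≤ 1`, `0 ≤ β ≤ 1`), ★ `lipMS_AdInv_of_printLetters` — THE ASSEMBLED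
   MULTI-SCALE MEMBER of `Z = Ad_{W⁻¹}(iηA)` in the letters of `N16HolderMSDefs.CovRootHolderMS` (`ξ = η`): plaquettes `≤ a ≤ α_W·η²` (`α_W ≤ 1`), `‖A‖ ≤ s`,
   `‖D^η_{W,μ}A_κ‖ ≤ g`, (3.40) quotient `≤ B` at the admissible pair `(y, y+j•e_μ)` with `len (j•e_μ) ≤ j`, `1 ≤ j`, `j·η ≤ 1` ⟹ the member with constant
   `Λ₂′ = B + 2α_W g + 8α_W s` (nearest-neighbour analogue: n16-a's `s₂ := hol + 8α_W s`; the new `2α_W g` is the ladder's price).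
HONEST FRAMING: kinematics + bookkeeping over landed modules; print's quotient bound is a HYPOTHESIS (node N05's [B8] Prop 3 at the pair, NOT proved here);
nothing of NE3 ∕ NE7 discharged; N16 ∕ NE3 NOT discharged; count-neutral; one finite four-torus at fixed ε — NOT ℝ⁴, NOT infinite volume, NOT OS, NOT a mass gap,
NOT Clay.
-/

set_option autoImplicit false

open scoped BigOperators Matrix Matrix.Norms.L2Operator
open NormedSpace

namespace Summit.QuantumFields.YangMills.BalabanUVNodes.N16HolderMSDictionary

open Literature.MathematicalPhysics.QuantumFieldTheory.Balaban1983to89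
open B7Prop1Explicit B7Prop2Explicit
open B7Eq78Linearization (conjR)
open B8Ineq132 (covDerivFwd)
open B8Eq146AExpansion (iEta)
open B8Lemma1NonAbelian (treeWord_zsmul_e)
open B9Eq340HolderZd (trans trans_def AdmPair mem_admPair hquot hquot_def)
open T4AveragingDeficitWall (IsUnitaryCfg SmallField Ad)
open T4AveragingDeficitNonAbelian (Ad_mul Ad_sub)
open Summit.QuantumFields.BalabanUV.T4Continuum
open AveragingDeficitTransport (norm_Ad_of_unitary mem_U1_of_unitary)
open AveragingDeficitNearIdentity (Ad_one Ad_smul Ad_add)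
open NE3.PairLandauB8 (covDiff)
open NE3.PairLeftChartB8 (covDiff_AdInv_eq norm_Ad_sub_self_le Ad_iEta_sub_eq_covDerivFwd norm_Ad_iEta_sub)
open NE7EtaCovariantJunction (lineHol_succ lineHol_mem_unitary)
open N16 (norm_Ad_plaq_sub_le)

noncomputable section

variable {d : ℕ} {n : Type*} [Fintype n] [DecidableEq n]

/-! ## §1 The line holonomy: word form `hol W b (seg μ j)` = the junction's product form; print's transport along a line -/

/-- **THE WORD HOLONOMY ALONG THE STRAIGHT SEGMENT IS THE LINE PRODUCT**: `hol W b (seg μ j) = W(b,μ)·W(b+e_μ,μ)⋯W(b+(j−1)•e_μ,μ)` — the holonomy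
`((List.range j).map fun i ↦ W (b + i • e μ) μ).prod` of `NE7EtaCovariantJunction` §3. [folklore] -/
theorem hol_seg_nat_eq_lineProd (W : Site d → Fin d → (Matrix n n ℂ)ˣ) (b : Site d) (μ : Fin d) :
    ∀ j : ℕ, hol W b (seg μ (j : ℤ)) = ((List.range j).map fun i : ℕ => W (b + i • e μ) μ).prod
  | 0 => by simp
  | j + 1 => by
    rw [lineHol_succ, ← hol_seg_nat_eq_lineProd W b μ j, show ((j + 1 : ℕ) : ℤ) = (j : ℤ) + 1 by push_cast; rfl,
      hol_seg_natCast_succ, natCast_zsmul]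

/-- **PRINT's (3.40) TRANSPORT ALONG A LATTICE LINE**: `R(W(Γ_{y, y+j•e_μ}))X = Ad (hol W y (seg μ j)) X` — the staircase contour to `y + j•e_μ` is the
straight segment (`treeWord_zsmul_e`), and `conjR = Ad`. [cite: Balaban1985BackgroundPropagators, (3.40) p.397] [folklore] -/
theorem trans_line_eq_Ad_hol_seg (W : Site d → Fin d → (Matrix n n ℂ)ˣ) (y : Site d) (μ : Fin d) (j : ℕ) (X : Matrix n n ℂ) :
    trans W y (y + j • e μ) X = Ad (hol W y (seg μ (j : ℤ))) X := by
  rw [trans_def, add_sub_cancel_left, ← natCast_zsmul, treeWord_zsmul_e]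
  rfl

/-! ## §2 The `j × 1` ladder loop on a small-field configuration -/

/-- **THE DEGENERATE LADDER** (`κ = μ`): the «ladder» over `seg μ j` with rungs along `μ` itself retraces the line, so its holonomy is `1`. [folklore] -/
theorem hol_ladder_seg_self (W : Site d → Fin d → (Matrix n n ℂ)ˣ) (y : Site d) (μ : Fin d) (j : ℕ) :
    hol W y (ladder (seg μ (j : ℤ)) μ) = 1 := by
  rw [hol_ladder, disp_seg]
  -- `hol_y (seg μ j) · W(y + j•e μ, μ) = hol_y (seg μ (j+1)) = W(y,μ) · hol_{y+e μ} (seg μ j)`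
  have h1 : hol W y (seg μ (j : ℤ)) * W (y + (j : ℤ) • e μ) μ = hol W y (seg μ ((j : ℤ) + 1)) := (hol_seg_natCast_succ W y μ j).symm
  have h2 : hol W y (seg μ ((j : ℤ) + 1)) = W y μ * hol W (y + e μ) (seg μ (j : ℤ)) := by
    rw [show (j : ℤ) + 1 = ((j + 1 : ℕ) : ℤ) by push_cast; rfl, seg_natCast, seg_natCast, List.replicate_succ, hol_cons, stepHol_true,
      Letter.vec_true]
  rw [h1, h2]
  group

/-- **THE LADDER ESTIMATE FOR THE STRAIGHT SEGMENT** (non-abelian Stokes, crude form): for a unitary configuration in `SmallField W a` (`a ≥ 0`), the holonomy of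
the ladder loop over `seg μ j` with rungs along `κ` — the boundary of the `j × 1` rectangle `y → y+j•e_μ → y+j•e_μ+e_κ → y+e_κ → y` when `κ ≠ μ` — is within
`j·a` of `1` (`B7Prop1Explicit.ladder_bound` with the elementary loops bounded by `SmallField`; the degenerate `κ = μ` has holonomy `1`).
[cite: Balaban1985Averaging, (44) p.24, p.25] [folklore] -/
theorem norm_hol_ladder_seg_sub_one_le [Nonempty n] {W : Site d → Fin d → (Matrix n n ℂ)ˣ} (hW : IsUnitaryCfg W) {a : ℝ} (ha : 0 ≤ a)
    (hWa : SmallField W a) (y : Site d) (κ μ : Fin d) (j : ℕ) :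
    ‖((hol W y (ladder (seg μ (j : ℤ)) κ) : (Matrix n n ℂ)ˣ) : Matrix n n ℂ) - 1‖ ≤ j * a := by
  by_cases hκμ : κ = μ
  · subst hκμ
    rw [hol_ladder_seg_self, Units.val_one, sub_self, norm_zero]
    positivity
  · letI : CStarAlgebra (Matrix n n ℂ) := {}
    have hU1 : ∀ x ν, W x ν ∈ U1 (Matrix n n ℂ) := fun x ν => mem_U1_of_unitary (hW x ν)
    have hP : ∀ (x : Site d) (l : Letter d), l.1 ≠ κ → ‖((hol W x (lplaqWord l κ) : (Matrix n n ℂ)ˣ) : Matrix n n ℂ) - 1‖ ≤ a :=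
      fun x l hl => norm_hol_lplaqWord_sub_one_le W hU1 (fun x ν ν' hνν' => hWa x ν ν' hνν') x l κ hl
    have hw : ∀ l ∈ seg μ (j : ℤ), l.1 ≠ κ := by
      intro l hl
      rw [seg_natCast, List.mem_replicate] at hl
      rw [hl.2]
      exact fun h => hκμ h.symm
    have h := ladder_bound W hU1 κ hP (seg μ (j : ℤ)) y hw
    rwa [length_seg, Int.natAbs_natCast] at h

/-! ## §3 END-line holonomy versus START-line holonomy -/

/-- **THE TWO LINE HOLONOMIES DIFFER BY THE LADDER**: with `H′_j` the line holonomy along `μ` from `y + e_κ` (THE END's frame line) and `H_j` the one from `y`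
(print's frame line), `H′_j · W(y+j•e_μ, κ)⁻¹ = W(y,κ)⁻¹ · W(ladder)⁻¹ · H_j` — `B7Prop1Explicit.hol_ladder` rearranged. [folklore] -/
theorem lineProd_mul_inv_eq (W : Site d → Fin d → (Matrix n n ℂ)ˣ) (y : Site d) (κ μ : Fin d) (j : ℕ) :
    ((List.range j).map fun i : ℕ => W (y + e κ + i • e μ) μ).prod * (W (y + j • e μ) κ)⁻¹
      = (W y κ)⁻¹ * (hol W y (ladder (seg μ (j : ℤ)) κ))⁻¹ * hol W y (seg μ (j : ℤ)) := by
  have hl := hol_ladder W y (seg μ (j : ℤ)) κ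
  rw [disp_seg, natCast_zsmul] at hl
  rw [← hol_seg_nat_eq_lineProd, hl]
  group

/-! ## §4 The multi-scale Hölder dictionary: identity and estimate -/

/-- **THE TRANSPORTED COVARIANT DIFFERENCE OF `Z = Ad_{W⁻¹}Y` AT SEPARATION `j`, EXACTLY**: with `H′_j` THE END's line holonomy from `y + e_κ`, `H_j = hol W y (seg μ j)`,
`Λ_j = W(ladder (seg μ j) κ)` and `P_z = W(∂p_{κμ}(z))`,
`Ad_{H′_j}(∇_μZ)(y+j•e_μ,κ) − (∇_μZ)(y,κ) = Ad_{W(y,κ)⁻¹}{ Ad_{Λ_j⁻¹}Ad_{H_j}[Ad_{P_{y+j e_μ}}Ad_{W(y+j e_μ,μ)}Y(y+(j+1)e_μ,κ) − Y(y+j e_μ,κ)] −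
[Ad_{P_y}Ad_{W(y,μ)}Y(y+e_μ,κ) − Y(y,κ)] }` (`∇_μ = PairLandauB8.covDiff W μ`; `N16PrintLetters.holderDiff_AdInv_eq` is `j = 1`). [folklore] -/
theorem holderDiffMS_AdInv_eq (W : Site d → Fin d → (Matrix n n ℂ)ˣ) (Y : Site d → Fin d → Matrix n n ℂ) (μ : Fin d) (y : Site d) (κ : Fin d)
    (j : ℕ) :
    Ad (((List.range j).map fun i : ℕ => W (y + e κ + i • e μ) μ).prod)
        (covDiff W μ (fun x μ => Ad (W x μ)⁻¹ (Y x μ)) (y + j • e μ) κ) - covDiff W μ (fun x μ => Ad (W x μ)⁻¹ (Y x μ)) y κ =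
      Ad (W y κ)⁻¹
        (Ad (hol W y (ladder (seg μ (j : ℤ)) κ))⁻¹ (Ad (hol W y (seg μ (j : ℤ)))
            (Ad (hol W (y + j • e μ) (plaqWord κ μ)) (Ad (W (y + j • e μ) μ) (Y (y + j • e μ + e μ) κ)) - Y (y + j • e μ) κ)) -
          (Ad (hol W y (plaqWord κ μ)) (Ad (W y μ) (Y (y + e μ) κ)) - Y y κ)) := by
  rw [covDiff_AdInv_eq, covDiff_AdInv_eq, ← Ad_mul, lineProd_mul_inv_eq, Ad_mul, Ad_mul, ← Ad_sub]

/-- **THE MULTI-SCALE HÖLDER DICTIONARY** (the estimate): for unitary `W` in `SmallField W a` (`a ≥ 0`), `η > 0`, `Z = Ad_{W⁻¹}(iEta η A)`, every lattice line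
(`κ μ`, base `y`) and every separation `j`:
`‖Ad_{H′_j}(∇_μZ)(y+j•e_μ,κ) − (∇_μZ)(y,κ)‖ ≤ η²·‖Ad_{H_j}(D^η_{W,μ}A_κ)(y+j•e_μ) − (D^η_{W,μ}A_κ)(y)‖`
`  + 2(j·a)·(η²‖D^η_{W,μ}A_κ(y+j•e_μ)‖ + 2a‖(iηA)(y+(j+1)•e_μ,κ)‖) + 2a(‖(iηA)(y+(j+1)•e_μ,κ)‖ + ‖(iηA)(y+e_μ,κ)‖)`
— the main term is `η²` × print's (3.40) transported difference along the line of the (1.1) derivative `D^η_{W,μ}A_κ = covDerivFwd η W μ (A · κ)` (§5 turns a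
quotient bound into its size), the second is the LADDER error (§2: `‖Λ_j − 1‖ ≤ j·a`), the last two are the END∕START plaquette insertions at the two ends.
[cite: Balaban1985BackgroundPropagators, (3.40) p.397; Balaban1985RegularSpaces, (1.36) p.82] [folklore] -/
theorem norm_holderDiffMS_AdInv_le [Nonempty n] {W : Site d → Fin d → (Matrix n n ℂ)ˣ} (hW : IsUnitaryCfg W) {a : ℝ} (ha : 0 ≤ a)
    (hWa : SmallField W a) {η : ℝ} (hη : 0 < η) (A : Site d → Fin d → Matrix n n ℂ) (μ : Fin d) (y : Site d) (κ : Fin d) (j : ℕ) :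
    ‖Ad (((List.range j).map fun i : ℕ => W (y + e κ + i • e μ) μ).prod)
          (covDiff W μ (fun x μ => Ad (W x μ)⁻¹ (iEta η A x μ)) (y + j • e μ) κ) -
        covDiff W μ (fun x μ => Ad (W x μ)⁻¹ (iEta η A x μ)) y κ‖ ≤
      η ^ 2 * ‖Ad (hol W y (seg μ (j : ℤ))) (covDerivFwd η W μ (fun z => A z κ) (y + j • e μ)) - covDerivFwd η W μ (fun z => A z κ) y‖ +
        2 * (j * a) * (η ^ 2 * ‖covDerivFwd η W μ (fun z => A z κ) (y + j • e μ)‖ + 2 * a * ‖iEta η A (y + j • e μ + e μ) κ‖) +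
        (2 * a * ‖iEta η A (y + j • e μ + e μ) κ‖ + 2 * a * ‖iEta η A (y + e μ) κ‖) := by
  letI : CStarAlgebra (Matrix n n ℂ) := {}
  rw [holderDiffMS_AdInv_eq, norm_Ad_of_unitary ((unitaryUnits _).inv_mem (hW y κ))]
  -- letters
  set Yj : Matrix n n ℂ := iEta η A (y + j • e μ + e μ) κ with hYj
  set Y1 : Matrix n n ℂ := iEta η A (y + e μ) κ with hY1
  set Gj : Matrix n n ℂ := Ad (W (y + j • e μ) μ) Yj - iEta η A (y + j • e μ) κ with hGj
  set G0 : Matrix n n ℂ := Ad (W y μ) Y1 - iEta η A y κ with hG0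
  set Ej : Matrix n n ℂ := Ad (hol W (y + j • e μ) (plaqWord κ μ)) (Ad (W (y + j • e μ) μ) Yj) - Ad (W (y + j • e μ) μ) Yj with hEj
  set E0 : Matrix n n ℂ := Ad (hol W y (plaqWord κ μ)) (Ad (W y μ) Y1) - Ad (W y μ) Y1 with hE0
  set H : (Matrix n n ℂ)ˣ := hol W y (seg μ (j : ℤ)) with hH
  set Λ : (Matrix n n ℂ)ˣ := hol W y (ladder (seg μ (j : ℤ)) κ) with hΛ
  have hU1 : ∀ x ν, W x ν ∈ U1 (Matrix n n ℂ) := fun x ν => mem_U1_of_unitary (hW x ν)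
  have hHu : H ∈ unitaryUnits (Matrix n n ℂ) := hol_mem_of hW _ _
  have hΛU1 : Λ⁻¹ ∈ U1 (Matrix n n ℂ) := (U1 _).inv_mem (hol_mem hU1 _ _)
  -- the decomposition: inner = [Ad H Gj − G0] + [(Ad Λ⁻¹ − 1)(Ad H (Gj + Ej))] + [Ad H Ej] − E0
  have hin1 : Ad (hol W (y + j • e μ) (plaqWord κ μ)) (Ad (W (y + j • e μ) μ) Yj) - iEta η A (y + j • e μ) κ = Gj + Ej := by
    rw [hGj, hEj]; abel
  have hin0 : Ad (hol W y (plaqWord κ μ)) (Ad (W y μ) Y1) - iEta η A y κ = G0 + E0 := by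
    rw [hG0, hE0]; abel
  have hsplit : Ad Λ⁻¹ (Ad H (Gj + Ej)) - (G0 + E0)
      = (Ad H Gj - G0) + ((Ad Λ⁻¹ (Ad H (Gj + Ej)) - Ad H (Gj + Ej)) + Ad H Ej - E0) := by
    rw [Ad_add]; abel
  rw [hin1, hin0, hsplit]
  -- the main term
  have hmain : Ad H Gj - G0 = ((Complex.I : ℂ) * η * η) •
      (Ad H (covDerivFwd η W μ (fun z => A z κ) (y + j • e μ)) - covDerivFwd η W μ (fun z => A z κ) y) := by
    rw [hGj, hG0, hYj, hY1, Ad_iEta_sub_eq_covDerivFwd hη.ne', Ad_iEta_sub_eq_covDerivFwd hη.ne', Ad_smul, smul_sub]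
  have hmain' : ‖Ad H Gj - G0‖ =
      η ^ 2 * ‖Ad H (covDerivFwd η W μ (fun z => A z κ) (y + j • e μ)) - covDerivFwd η W μ (fun z => A z κ) y‖ := by
    rw [hmain, norm_smul, norm_mul, norm_mul, Complex.norm_I, one_mul, Complex.norm_real, Real.norm_eq_abs, abs_of_pos hη, sq]
  -- sizes of the letters
  have hGjn : ‖Gj‖ = η ^ 2 * ‖covDerivFwd η W μ (fun z => A z κ) (y + j • e μ)‖ := by
    rw [hGj, hYj, show y + j • e μ + e μ = (y + j • e μ) + e μ from rfl]
    exact norm_Ad_iEta_sub hη W A μ (y + j • e μ) κ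
  have hEjn : ‖Ej‖ ≤ 2 * a * ‖Yj‖ := by
    have h := (norm_Ad_plaq_sub_le hW ha hWa (y + j • e μ) κ μ (Ad (W (y + j • e μ) μ) Yj)).1
    rwa [norm_Ad_of_unitary (hW _ _)] at h
  have hE0n : ‖E0‖ ≤ 2 * a * ‖Y1‖ := by
    have h := (norm_Ad_plaq_sub_le hW ha hWa y κ μ (Ad (W y μ) Y1)).1
    rwa [norm_Ad_of_unitary (hW _ _)] at h
  -- the ladder error
  have hΛn : ‖((Λ⁻¹ : (Matrix n n ℂ)ˣ) : Matrix n n ℂ) - 1‖ ≤ j * a :=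
    (norm_inv_sub_one_le (hol_mem hU1 _ _)).trans (norm_hol_ladder_seg_sub_one_le hW ha hWa y κ μ j)
  have hlad : ‖Ad Λ⁻¹ (Ad H (Gj + Ej)) - Ad H (Gj + Ej)‖ ≤ 2 * (j * a) * (‖Gj‖ + ‖Ej‖) := by
    calc ‖Ad Λ⁻¹ (Ad H (Gj + Ej)) - Ad H (Gj + Ej)‖ ≤ 2 * ‖((Λ⁻¹ : (Matrix n n ℂ)ˣ) : Matrix n n ℂ) - 1‖ * ‖Ad H (Gj + Ej)‖ :=
          norm_Ad_sub_self_le hΛU1 _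
      _ ≤ 2 * (j * a) * (‖Gj‖ + ‖Ej‖) := by
          rw [norm_Ad_of_unitary hHu]
          exact mul_le_mul (mul_le_mul_of_nonneg_left hΛn (by norm_num)) (norm_add_le _ _) (norm_nonneg _)
            (mul_nonneg (by norm_num) (mul_nonneg (Nat.cast_nonneg j) ha))
  have hHEj : ‖Ad H Ej‖ = ‖Ej‖ := norm_Ad_of_unitary hHu Ej
  have hja : 0 ≤ 2 * ((j : ℝ) * a) := by positivity
  calc ‖(Ad H Gj - G0) + ((Ad Λ⁻¹ (Ad H (Gj + Ej)) - Ad H (Gj + Ej)) + Ad H Ej - E0)‖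
      ≤ ‖Ad H Gj - G0‖ + (‖Ad Λ⁻¹ (Ad H (Gj + Ej)) - Ad H (Gj + Ej)‖ + ‖Ad H Ej‖ + ‖E0‖) := by
        refine (norm_add_le _ _).trans (add_le_add le_rfl ?_)
        exact (norm_sub_le _ _).trans (add_le_add (norm_add_le _ _) le_rfl)
    _ ≤ η ^ 2 * ‖Ad H (covDerivFwd η W μ (fun z => A z κ) (y + j • e μ)) - covDerivFwd η W μ (fun z => A z κ) y‖ +
          (2 * (j * a) * (η ^ 2 * ‖covDerivFwd η W μ (fun z => A z κ) (y + j • e μ)‖ + 2 * a * ‖Yj‖) + 2 * a * ‖Yj‖ + 2 * a * ‖Y1‖) := by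
        rw [hmain', hHEj]
        refine add_le_add le_rfl (add_le_add (add_le_add ?_ hEjn) hE0n)
        rw [← hGjn]
        exact hlad.trans (mul_le_mul_of_nonneg_left (add_le_add le_rfl hEjn) hja)
    _ = _ := by ring

/-! ## §5 From a bound on print's (3.40) quotient to the size of the transported difference -/

/-- **A QUOTIENT BOUND IS A HÖLDER BOUND**: at an admissible pair `p = (x, x′)` (`0 < len(x′ − x)`, `η·len(x′ − x) ≤ 1`) with `η > 0`, `hquot η β len W F p ≤ B` gives
`‖R(W(Γ_{x,x′}))F(x′) − F(x)‖ ≤ B·(η·len(x′ − x))^β`. [cite: Balaban1985BackgroundPropagators, (3.40) p.397] [folklore] -/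
theorem norm_trans_sub_le_of_hquot_le {η β : ℝ} (hη : 0 < η) {len : Site d → ℝ} {W : Site d → Fin d → (Matrix n n ℂ)ˣ}
    {F : Site d → Matrix n n ℂ} {p : Site d × Site d} (hp : p ∈ AdmPair η len) {B : ℝ} (hB : hquot η β len W F p ≤ B) :
    ‖trans W p.1 p.2 (F p.2) - F p.1‖ ≤ B * (η * len (p.2 - p.1)) ^ β := by
  have hpos : 0 < (η * len (p.2 - p.1)) ^ β := Real.rpow_pos_of_pos (mul_pos hη (mem_admPair.mp hp).1) β
  rw [hquot_def, div_le_iff₀ hpos] at hB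
  exact hB

/-- **… ALONG A LATTICE LINE, IN THE LETTER OF §4**: if the pair `(y, y + j•e_μ)` is admissible, `len (j•e_μ) ≤ j`, `β ≥ 0` and the (3.40) quotient of
`F = D^η_{W,μ}A_κ` there is `≤ B` (`B ≥ 0`), then `‖Ad (hol W y (seg μ j)) (F (y + j•e_μ)) − F y‖ ≤ B·(η·j)^β`.
[cite: Balaban1985BackgroundPropagators, (3.40) p.397] [folklore] -/
theorem norm_Ad_hol_seg_sub_le_of_hquot_le {η β : ℝ} (hη : 0 < η) (hβ : 0 ≤ β) {len : Site d → ℝ} {W : Site d → Fin d → (Matrix n n ℂ)ˣ}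
    {F : Site d → Matrix n n ℂ} {y : Site d} {μ : Fin d} {j : ℕ} (hp : (y, y + j • e μ) ∈ AdmPair η len) (hlen : len (j • e μ) ≤ j)
    {B : ℝ} (hB0 : 0 ≤ B) (hB : hquot η β len W F (y, y + j • e μ) ≤ B) :
    ‖Ad (hol W y (seg μ (j : ℤ))) (F (y + j • e μ)) - F y‖ ≤ B * (η * j) ^ β := by
  have h := norm_trans_sub_le_of_hquot_le hη hp hB
  rw [trans_line_eq_Ad_hol_seg] at h
  simp only [add_sub_cancel_left] at h
  have hl0 : 0 < len (j • e μ) := by simpa using (mem_admPair.mp hp).1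
  refine h.trans (mul_le_mul_of_nonneg_left ?_ hB0)
  exact Real.rpow_le_rpow (mul_nonneg hη.le hl0.le) (mul_le_mul_of_nonneg_left hlen hη.le) hβ

/-! ## §6 The assembled multi-scale member in the letters of `CovRootHolderMS` -/

/-- Real-power bookkeeping for the error terms: for `0 < η ≤ 1`, `1 ≤ j`, `j·η ≤ 1`, `0 ≤ β ≤ 1`:
`j·η⁴ ≤ η^{2+β}·j^β`, `η³ ≤ η^{2+β}·j^β` and `j·η⁵ ≤ η^{2+β}·j^β`. [folklore] -/
theorem msError_rpow_bounds {η β : ℝ} {j : ℕ} (hη : 0 < η) (hη1 : η ≤ 1) (hj : 1 ≤ j) (hjη : (j : ℝ) * η ≤ 1) (hβ0 : 0 ≤ β)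
    (hβ1 : β ≤ 1) :
    (j : ℝ) * η ^ 4 ≤ η ^ ((2 : ℝ) + β) * (j : ℝ) ^ β ∧ η ^ 3 ≤ η ^ ((2 : ℝ) + β) * (j : ℝ) ^ β ∧
      (j : ℝ) * η ^ 5 ≤ η ^ ((2 : ℝ) + β) * (j : ℝ) ^ β := by
  have hj0 : (0 : ℝ) < j := by exact_mod_cast hj
  have hj1 : (1 : ℝ) ≤ j := by exact_mod_cast hj
  have hsplit : η ^ ((2 : ℝ) + β) * (j : ℝ) ^ β = η ^ 2 * ((j : ℝ) * η) ^ β := by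
    rw [Real.rpow_add hη, show (2 : ℝ) = ((2 : ℕ) : ℝ) by norm_num, Real.rpow_natCast, Real.mul_rpow hj0.le hη.le]; ring
  -- `(jη) ≤ (jη)^β` and `η ≤ η^β` on `[0,1]` for `β ≤ 1`; `1 ≤ j^β`
  have hx : (j : ℝ) * η ≤ ((j : ℝ) * η) ^ β := by
    have h := Real.rpow_le_rpow_of_exponent_ge (mul_pos hj0 hη) hjη hβ1
    rwa [Real.rpow_one] at h
  have hηβ : η ≤ η ^ β := by
    have h := Real.rpow_le_rpow_of_exponent_ge hη hη1 hβ1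
    rwa [Real.rpow_one] at h
  have hjβ : 1 ≤ (j : ℝ) ^ β := Real.one_le_rpow hj1 hβ0
  have hη2 : 0 < η ^ 2 := by positivity
  have hη21 : η ^ 2 ≤ 1 := pow_le_one₀ hη.le hη1
  have hxβ0 : 0 ≤ ((j : ℝ) * η) ^ β := Real.rpow_nonneg (mul_nonneg hj0.le hη.le) β
  refine ⟨?_, ?_, ?_⟩
  · -- j η⁴ = η² · (jη) · η ≤ η² · (jη)^β
    rw [hsplit]
    have : (j : ℝ) * η ^ 4 = η ^ 2 * (((j : ℝ) * η) * η) := by ring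
    rw [this]
    refine mul_le_mul_of_nonneg_left ?_ hη2.le
    calc (j : ℝ) * η * η ≤ ((j : ℝ) * η) ^ β * 1 := mul_le_mul hx hη1 hη.le hxβ0
      _ = ((j : ℝ) * η) ^ β := mul_one _
  · -- η³ = η²·η ≤ η²·η^β·j^β
    rw [Real.rpow_add hη, show (2 : ℝ) = ((2 : ℕ) : ℝ) by norm_num, Real.rpow_natCast]
    have : η ^ 3 = η ^ 2 * (η * 1) := by ring
    rw [this, mul_assoc]
    exact mul_le_mul_of_nonneg_left (mul_le_mul hηβ hjβ zero_le_one (Real.rpow_nonneg hη.le β)) hη2.le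
  · -- j η⁵ ≤ j η⁴ · η ≤ η²(jη)^β
    rw [hsplit]
    have : (j : ℝ) * η ^ 5 = η ^ 2 * (((j : ℝ) * η) * η ^ 2) := by ring
    rw [this]
    refine mul_le_mul_of_nonneg_left ?_ hη2.le
    calc (j : ℝ) * η * η ^ 2 ≤ ((j : ℝ) * η) ^ β * 1 := mul_le_mul hx hη21 (by positivity) hxβ0
      _ = ((j : ℝ) * η) ^ β := mul_one _

/-- **THE MULTI-SCALE MEMBER OF `Z = Ad_{W⁻¹}(iηA)` FROM PRINT's LETTERS** — the dictionary brick the multi-scale twins of (OUT_print) → `LandauRepB8` → END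
consume: `W` unitary with plaquettes `≤ a ≤ α_W·η²` (`0 ≤ α_W ≤ 1`), `0 < η ≤ 1`, `0 ≤ β ≤ 1`; print's letters (1.36)₁ `‖A‖ ≤ s`, (1.36)₂ `‖D^η_{W,μ}A_κ‖ ≤ g` and
(1.36)₃ = (3.40) «the quotient of `D^η_{W,μ}A_κ` at the admissible pair `(y, y + j•e_μ)` is `≤ B`» (`B ≥ 0`, `len (j•e_μ) ≤ j`), separation `1 ≤ j` with `j·η ≤ 1`.
THEN, in the letters of `N16HolderMSDefs.CovRootHolderMS` (`ξ = η`):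
`‖Ad(H′_j)[Ad (W (y+e κ+j•e μ) μ) (Z (y+(j+1)•e μ) κ) − Z (y+j•e μ) κ] − [Ad (W (y+e κ) μ) (Z (y+e μ) κ) − Z y κ]‖ ≤ (B + 2α_W g + 8α_W s)·η^{2+β}·j^β`.
[cite: Balaban1985BackgroundPropagators, (3.40) p.397; Balaban1985RegularSpaces, (1.36) p.82] [folklore] -/
theorem lipMS_AdInv_of_printLetters [Nonempty n] {W : Site d → Fin d → (Matrix n n ℂ)ˣ} (hW : IsUnitaryCfg W) {a αW η β s g B : ℝ}
    (hWa : SmallField W a) (haW : a ≤ αW * η ^ 2) (ha : 0 ≤ a) (hαW1 : αW ≤ 1) (hη : 0 < η) (hη1 : η ≤ 1) (hβ0 : 0 ≤ β) (hβ1 : β ≤ 1)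
    {len : Site d → ℝ} {A : Site d → Fin d → Matrix n n ℂ} (hs : ∀ x ν, ‖A x ν‖ ≤ s) {μ κ : Fin d}
    (hg : ∀ z, ‖covDerivFwd η W μ (fun z => A z κ) z‖ ≤ g) {y : Site d} {j : ℕ} (hj : 1 ≤ j) (hjη : (j : ℝ) * η ≤ 1)
    (hp : (y, y + j • e μ) ∈ AdmPair η len) (hlen : len (j • e μ) ≤ j) (hB0 : 0 ≤ B)
    (hB : hquot η β len W (covDerivFwd η W μ (fun z => A z κ)) (y, y + j • e μ) ≤ B) :
    ‖Ad (((List.range j).map fun i : ℕ => W (y + e κ + i • e μ) μ).prod)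
          (Ad (W (y + e κ + j • e μ) μ) ((fun x ν => Ad (W x ν)⁻¹ (iEta η A x ν)) (y + (j + 1) • e μ) κ) -
            (fun x ν => Ad (W x ν)⁻¹ (iEta η A x ν)) (y + j • e μ) κ) -
        (Ad (W (y + e κ) μ) ((fun x ν => Ad (W x ν)⁻¹ (iEta η A x ν)) (y + e μ) κ) - (fun x ν => Ad (W x ν)⁻¹ (iEta η A x ν)) y κ)‖
      ≤ (B + 2 * αW * g + 8 * αW * s) * η ^ ((2 : ℝ) + β) * (j : ℝ) ^ β := by
  -- rewrite the two differences as `covDiff`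
  have e1 : Ad (W (y + e κ + j • e μ) μ) ((fun x ν => Ad (W x ν)⁻¹ (iEta η A x ν)) (y + (j + 1) • e μ) κ) -
      (fun x ν => Ad (W x ν)⁻¹ (iEta η A x ν)) (y + j • e μ) κ
      = covDiff W μ (fun x ν => Ad (W x ν)⁻¹ (iEta η A x ν)) (y + j • e μ) κ := by
    unfold covDiff
    rw [show y + e κ + j • e μ = y + j • e μ + e κ by abel, show y + (j + 1) • e μ = y + j • e μ + e μ by rw [succ_nsmul, add_assoc]]
  have e0 : Ad (W (y + e κ) μ) ((fun x ν => Ad (W x ν)⁻¹ (iEta η A x ν)) (y + e μ) κ) - (fun x ν => Ad (W x ν)⁻¹ (iEta η A x ν)) y κ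
      = covDiff W μ (fun x ν => Ad (W x ν)⁻¹ (iEta η A x ν)) y κ := rfl
  rw [e1, e0]
  have h := norm_holderDiffMS_AdInv_le hW ha hWa hη A μ y κ j
  -- the letters
  have hmain : ‖Ad (hol W y (seg μ (j : ℤ))) (covDerivFwd η W μ (fun z => A z κ) (y + j • e μ)) - covDerivFwd η W μ (fun z => A z κ) y‖
      ≤ B * (η * j) ^ β := norm_Ad_hol_seg_sub_le_of_hquot_le hη hβ0 hp hlen hB0 hB
  have hYj : ‖iEta η A (y + j • e μ + e μ) κ‖ ≤ η * s := by
    rw [NE3.PairLeftChartB8.norm_iEta hη.le]; exact mul_le_mul_of_nonneg_left (hs _ _) hη.le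
  have hY1 : ‖iEta η A (y + e μ) κ‖ ≤ η * s := by
    rw [NE3.PairLeftChartB8.norm_iEta hη.le]; exact mul_le_mul_of_nonneg_left (hs _ _) hη.le
  have hgj := hg (y + j • e μ)
  obtain ⟨hb4, hb3, hb5⟩ := msError_rpow_bounds hη hη1 hj hjη hβ0 hβ1
  have hαW0 : 0 ≤ αW := by nlinarith [pow_pos hη 2]
  have hs0 : 0 ≤ s := (norm_nonneg _).trans (hs y κ)
  have hg0 : 0 ≤ g := (norm_nonneg _).trans (hg y)
  have hj0 : (0 : ℝ) ≤ j := Nat.cast_nonneg j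
  have hηj : (η * j) ^ β = η ^ β * (j : ℝ) ^ β := Real.mul_rpow hη.le hj0
  have hR : η ^ ((2 : ℝ) + β) * (j : ℝ) ^ β = η ^ 2 * (η ^ β * (j : ℝ) ^ β) := by
    rw [Real.rpow_add hη, show (2 : ℝ) = ((2 : ℕ) : ℝ) by norm_num, Real.rpow_natCast]; ring
  set R : ℝ := η ^ ((2 : ℝ) + β) * (j : ℝ) ^ β with hRdef
  have hR0 : 0 ≤ R := mul_nonneg (Real.rpow_nonneg hη.le _) (Real.rpow_nonneg hj0 _)
  -- term by term
  have t1 : η ^ 2 * ‖Ad (hol W y (seg μ (j : ℤ))) (covDerivFwd η W μ (fun z => A z κ) (y + j • e μ)) - covDerivFwd η W μ (fun z => A z κ) y‖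
      ≤ B * R := by
    calc _ ≤ η ^ 2 * (B * (η * j) ^ β) := mul_le_mul_of_nonneg_left hmain (by positivity)
      _ = B * R := by rw [hR, hηj]; ring
  have t2 : 2 * (j * a) * (η ^ 2 * ‖covDerivFwd η W μ (fun z => A z κ) (y + j • e μ)‖ + 2 * a * ‖iEta η A (y + j • e μ + e μ) κ‖)
      ≤ 2 * αW * g * R + 4 * αW * s * R := by
    have i1 : 2 * (j * a) * (η ^ 2 * ‖covDerivFwd η W μ (fun z => A z κ) (y + j • e μ)‖) ≤ 2 * αW * g * ((j : ℝ) * η ^ 4) := by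
      have : 2 * αW * g * ((j : ℝ) * η ^ 4) = 2 * (j * (αW * η ^ 2)) * (η ^ 2 * g) := by ring
      rw [this]
      exact mul_le_mul (mul_le_mul_of_nonneg_left (mul_le_mul_of_nonneg_left haW hj0) (by norm_num))
        (mul_le_mul_of_nonneg_left hgj (by positivity)) (by positivity) (by positivity)
    have i2 : 2 * (j * a) * (2 * a * ‖iEta η A (y + j • e μ + e μ) κ‖) ≤ 4 * αW * s * ((j : ℝ) * η ^ 5) := by
      have e : 4 * αW * s * ((j : ℝ) * η ^ 5) = 2 * (j * (αW * η ^ 2)) * (2 * (1 * η ^ 2) * (η * s)) := by ring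
      rw [e]
      have ha2 : a ≤ 1 * η ^ 2 := haW.trans (by nlinarith [pow_pos hη 2])
      exact mul_le_mul (mul_le_mul_of_nonneg_left (mul_le_mul_of_nonneg_left haW hj0) (by norm_num))
        (mul_le_mul (mul_le_mul_of_nonneg_left ha2 (by norm_num)) hYj (norm_nonneg _) (by positivity)) (by positivity) (by positivity)
    rw [mul_add]
    refine add_le_add (i1.trans ?_) (i2.trans ?_)
    · exact mul_le_mul_of_nonneg_left hb4 (by positivity)
    · exact mul_le_mul_of_nonneg_left hb5 (by positivity)
  have t3 : 2 * a * ‖iEta η A (y + j • e μ + e μ) κ‖ + 2 * a * ‖iEta η A (y + e μ) κ‖ ≤ 4 * αW * s * R := by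
    have i3 : 2 * a * ‖iEta η A (y + j • e μ + e μ) κ‖ + 2 * a * ‖iEta η A (y + e μ) κ‖ ≤ 4 * αW * s * η ^ 3 := by
      have e : 4 * αW * s * η ^ 3 = 2 * (αW * η ^ 2) * (η * s) + 2 * (αW * η ^ 2) * (η * s) := by ring
      rw [e]
      exact add_le_add (mul_le_mul (mul_le_mul_of_nonneg_left haW (by norm_num)) hYj (norm_nonneg _) (by positivity))
        (mul_le_mul (mul_le_mul_of_nonneg_left haW (by norm_num)) hY1 (norm_nonneg _) (by positivity))
    exact i3.trans (mul_le_mul_of_nonneg_left hb3 (by positivity))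
  calc _ ≤ _ := h
    _ ≤ B * R + (2 * αW * g * R + 4 * αW * s * R) + 4 * αW * s * R := add_le_add (add_le_add t1 t2) t3
    _ = (B + 2 * αW * g + 8 * αW * s) * R := by ring
    _ = (B + 2 * αW * g + 8 * αW * s) * η ^ ((2 : ℝ) + β) * (j : ℝ) ^ β := by rw [hRdef]; ring

end

end Summit.QuantumFields.YangMills.BalabanUVNodes.N16HolderMSDictionary
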